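import Literature.Barriers.QuantumFields.NoClassicalGlueballsStressTensor
import HarnessLib

/-!
# No classical glueballs / decay of classical Yang–Mills fields: the inversional current (definitions)

Sibling of `Literature/Barriers/QuantumFields/NoClassicalGlueballs.lean` (barrier catalogue
D-0021, summit `QuantumFields`), on top of `NoClassicalGlueballsStressTensor.lean` (the stress
tensor `θ_{μν} = stressTensor B A μ ν` of a classical Yang–Mills field for an invariant positive
form `B`, with `∂^μ θ_{μν} = 0` proved there). Towards the named fact
`GlasseyStraussLocalEnergyDecay` (Glassey–Strauss, CMP 65 (1979), §4 Theorem) this file defines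
the ingredients of the **first inversional conservation law** (Glassey–Strauss §3 (13)), in the
abstract setting of `NoClassicalGlueballsStressTensor` (any coefficient algebra `𝔸`, any form `B`):

* `inversionField t₀ ν x = K^ν(x)`: the (contravariant components of the) conformal Killing field
  `K = ((x⁰ − t₀)² + r²) ∂₀ + 2 (x⁰ − t₀) xⁱ ∂ᵢ` of Minkowski space `ℝ^{1+3}` — the generator of
  the inversional law composed with the time translation by `t₀` (`∂_μ K_ν + ∂_ν K_μ =
  4(x⁰ − t₀) η_{μν}`);
* `conformalCurrent B A t₀ μ x = J^μ(x) = η^{μμ} Σ_ν θ_{μν} K^ν`, the associated Noether current;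
  in the chart `(t, y) = ofTimeSpace t y` its density is
  `J⁰ = ((t − t₀)² + |y|²) θ₀₀ + 2 (t − t₀) Σ_j y_j θ_{0j}` (`conformalCurrent_zero_ofTimeSpace`),
  which is Glassey–Strauss' `(r² + t²) e + 2t Σ_j x_j p_j` of (13) (their `p_j = θ_{0j}` in the
  present all-lower-index convention, cf. (e): `∂e/∂t = Σ ∂p_k/∂x_k`), and equals `|y|² e` at
  `t = t₀` (`conformalCurrent_zero_ofTimeSpace_self`) — the weight of the hypothesis
  `∫ r² e dx < ∞` of the §4 Theorem;
* `stressTensor_symm`: `θ_{μν} = θ_{νμ}` for a symmetric form.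

The conservation law `∂_μ J^μ = 0`, the flux inequalities and the decay theorem are proved in the
sibling `…Proofs` files.

## References

* R. T. Glassey, W. A. Strauss, *Decay of classical Yang–Mills fields*, Commun. Math. Phys. 65
  (1979) 1–13, §3 (e), (11), (13); §4 [GlasseyStrauss1979].
* S. Coleman, *There are no classical glueballs*, Commun. Math. Phys. 55 (1977) 113–116, §2 (3)–(5)
  [Coleman1977].
-/

noncomputable section

open scoped ContDiff

namespace Literature.Barriers.QuantumFields

open Literature.MathematicalPhysics.QuantumLattice

variable {𝔸 : Type*} [NormedRing 𝔸] [NormedAlgebra ℝ 𝔸]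

/-- The stress tensor of a symmetric form is symmetric: `θ_{μν} = θ_{νμ}`.
[cite: Coleman1977, §2 (3)] -/
theorem stressTensor_symm {𝔤 : Submodule ℝ 𝔸} {B : 𝔸 →L[ℝ] 𝔸 →L[ℝ] ℝ} (hB : IsInvariantForm 𝔤 B)
    (A : Connection (SpaceTime 3) 𝔸) (μ ν : Fin 4) (x : SpaceTime 3) :
    stressTensor B A μ ν x = stressTensor B A ν μ x := by
  unfold stressTensor
  congr 1
  · congr 1
    exact Finset.sum_congr rfl fun ρ _ => by rw [hB.symm]
  · by_cases h : μ = ν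
    · subst h; rfl
    · rw [if_neg h, if_neg (Ne.symm h)]

/-- The **conformal Killing field of the inversional law**, contravariant components
`K^ν(x)`: `K = ((x⁰ − t₀)² + r²) ∂₀ + 2 (x⁰ − t₀) xⁱ ∂ᵢ` (`r² = Σᵢ (xⁱ)²`), i.e.
`K⁰ = (x⁰ − t₀)² + r²`, `Kⁱ = 2 (x⁰ − t₀) xⁱ`; for `t₀ = 0` this is the vector field whose Noether
charge is Glassey–Strauss' first inversional quantity (13). [cite: GlasseyStrauss1979, §3 (13)] -/
def inversionField (t₀ : ℝ) (ν : Fin 4) (x : SpaceTime 3) : ℝ :=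
  if ν = 0 then (x 0 - t₀) ^ 2 + ∑ i : Fin 3, x i.succ ^ 2 else 2 * (x 0 - t₀) * x ν

/-- **The inversional current** `J^μ = η^{μμ} Σ_ν θ_{μν} K^ν` of a classical Yang–Mills field
(`θ` = `stressTensor B A`, all indices of `θ` lowered, `K` = `inversionField t₀`), whose
conservation `∂_μ J^μ = 0` is the first inversional identity (13) of Glassey–Strauss.
[cite: GlasseyStrauss1979, §3 (13)] -/
def conformalCurrent (B : 𝔸 →L[ℝ] 𝔸 →L[ℝ] ℝ) (A : Connection (SpaceTime 3) 𝔸) (t₀ : ℝ)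
    (μ : Fin 4) (x : SpaceTime 3) : ℝ :=
  metricDiag μ * ∑ ν, stressTensor B A μ ν x * inversionField t₀ ν x

/-- `K⁰(t, y) = (t − t₀)² + |y|²`. [folklore] -/
theorem inversionField_zero_ofTimeSpace (t₀ t : ℝ) (y : EuclideanSpace ℝ (Fin 3)) :
    inversionField t₀ 0 (ofTimeSpace t y) = (t - t₀) ^ 2 + ‖y‖ ^ 2 := by
  simp [inversionField, EuclideanSpace.real_norm_sq_eq]

/-- `Kⁱ(t, y) = 2 (t − t₀) yᵢ`. [folklore] -/
theorem inversionField_succ_ofTimeSpace (t₀ t : ℝ) (y : EuclideanSpace ℝ (Fin 3)) (i : Fin 3) :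
    inversionField t₀ i.succ (ofTimeSpace t y) = 2 * (t - t₀) * y i := by
  simp [inversionField, Fin.succ_ne_zero]

variable (B : 𝔸 →L[ℝ] 𝔸 →L[ℝ] ℝ) (A : Connection (SpaceTime 3) 𝔸)

/-- **The inversional density in the chart `(t, y)`**:
`J⁰(t, y) = ((t − t₀)² + |y|²) θ₀₀ + 2 (t − t₀) Σ_i y_i θ_{0i}` — Glassey–Strauss'
`(r² + t²) e + 2t Σ_j x_j p_j` of (13) for `t₀ = 0`. [cite: GlasseyStrauss1979, §3 (13)] -/
theorem conformalCurrent_zero_ofTimeSpace (t₀ t : ℝ) (y : EuclideanSpace ℝ (Fin 3)) :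
    conformalCurrent B A t₀ 0 (ofTimeSpace t y) =
      ((t - t₀) ^ 2 + ‖y‖ ^ 2) * stressTensor B A 0 0 (ofTimeSpace t y) +
        2 * (t - t₀) * ∑ i : Fin 3, y i * stressTensor B A 0 i.succ (ofTimeSpace t y) := by
  rw [conformalCurrent, Fin.sum_univ_succ, inversionField_zero_ofTimeSpace, metricDiag_zero, one_mul]
  simp only [inversionField_succ_ofTimeSpace]
  rw [Finset.mul_sum]
  congr 1
  · ring
  · exact Finset.sum_congr rfl fun i _ => by ring

/-- The spatial components of the inversional current in the chart `(t, y)`: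
`Jʲ(t, y) = −(((t − t₀)² + |y|²) θ_{j0} + 2 (t − t₀) Σ_i y_i θ_{ji})` (`η^{jj} = −1`).
[cite: GlasseyStrauss1979, §3 (13)] -/
theorem conformalCurrent_succ_ofTimeSpace (t₀ t : ℝ) (y : EuclideanSpace ℝ (Fin 3)) (j : Fin 3) :
    conformalCurrent B A t₀ j.succ (ofTimeSpace t y) =
      -(((t - t₀) ^ 2 + ‖y‖ ^ 2) * stressTensor B A j.succ 0 (ofTimeSpace t y) +
        2 * (t - t₀) * ∑ i : Fin 3, y i * stressTensor B A j.succ i.succ (ofTimeSpace t y)) := by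
  rw [conformalCurrent, Fin.sum_univ_succ, inversionField_zero_ofTimeSpace, metricDiag_succ]
  simp only [inversionField_succ_ofTimeSpace]
  rw [Finset.mul_sum, neg_one_mul]
  congr 1
  congr 1
  · ring
  · exact Finset.sum_congr rfl fun i _ => by ring

variable {B}

/-- At the central time `t = t₀` the inversional density is the weighted energy density,
`J⁰(t₀, y) = |y|² e(t₀, y)` — the quantity assumed integrable ("`∫ r² e dx < ∞`") in the
Glassey–Strauss theorem. [cite: GlasseyStrauss1979, §4 Theorem] -/
theorem conformalCurrent_zero_ofTimeSpace_self {𝔤 : Submodule ℝ 𝔸} (hB : IsInvariantForm 𝔤 B)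
    (t₀ : ℝ) (y : EuclideanSpace ℝ (Fin 3)) :
    conformalCurrent B A t₀ 0 (ofTimeSpace t₀ y) = ‖y‖ ^ 2 * ymEnergyDensity A (ofTimeSpace t₀ y) := by
  rw [conformalCurrent_zero_ofTimeSpace, stressTensor_zero_zero hB]
  simp

end Literature.Barriers.QuantumFields
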